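import Summits.BirchSwinnertonDyer.BirchSwinnertonDyer.Theorems.TwoAdicConverseBDPSplitPrimeIwasawaModuleTorsionHolds
import Summits.BirchSwinnertonDyer.BirchSwinnertonDyer.Theorems.TwoAdicConverseBDPSplitLineFiniteOfTwoPrintFacts
import HarnessLib

/-!
# Crux O2 `BDPSelmerLowerDivisibilityAtTwo` (stmt-BirchSwinnertonDyer-24728), line `two_variable_gv_squeeze_two` v8: the GL(1)
# leaf P4 and P1 (`SplitPrimeLineSelmerFiniteAt`) on habitat (β) MODULO ONE PRINT FACT — Oukhaba–Viguié 2016 Thm 1.2 (`μ = 0`) —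
# now that Greenberg 1978 §4 is a KERNEL theorem (`TwoAdicBDPSplitPrimeTorsion.greenberg1978_splitPrime_iwasawaModule_finite_torsion_holds`)

Cell `bsd-2adic`, seat `bsd-2adic-conv-1` GEN 41 (`--supports stmt-BirchSwinnertonDyer-24728`, helper; by-name convenience for the
lead's next re-cut). THEOREMS ONLY: no definition, no named fact, no instance, no `sorry`; the remaining print fact stays a DISPLAYED
hypothesis (`Literature.NumberTheory.IwasawaTheory.OukhabaViguie2016.thm12_splitPrime_muInvariant_eq_zero`, t42 GEN 36); O2 / 19556 /
19218 stay OPEN; BSD is proved for no curve by any of this.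

* `finite_pTorsion_unrSelmer_empty_of_muZero` / `finite_pTorsion_unrSelmer_of_muZero` — t42's
  `TwoAdicBDPTrivialCharLine.finite_pTorsion_unrSelmer_empty_of_printFacts` / `…_of_printFacts` (ANY `p`, ANY finite `S₀`) with
  `hGr := greenberg1978_splitPrime_iwasawaModule_finite_torsion_holds` and `hdec := deShalit1987_propII19iii_holds`;
* `trivialCharSplitLineFiniteAtTwo_of_muZero (hOV) (K)` — v8's P4 `TrivialCharSplitLineFiniteAtTwo` (unfolded) under ONE binder;
* `lineSelmerTwoTorsionFinite_of_muZero (W) (K) (hred) (hOV)` — seat 2's P1 `SplitPrimeLineSelmerFiniteAt W K` (unfolded) on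
  habitat (β) under the same single print fact (P5 ∘ P4).
FOR THE LEAD (v9, by name): `theorem trivialCharSplitLineFinite_of_muZero (hOV : OukhabaViguie2016.thm12_splitPrime_muInvariant_eq_zero) :
TrivialCharSplitLineFiniteAtTwo := fun K _ _ ↦ TwoAdicBDPEisensteinDevissage.trivialCharSplitLineFiniteAtTwo_of_muZero hOV K`.

References: [Greenberg1978] §4 (now kernel); [OukhabaViguie2016MuInvariant] Thm 1.2; [deShalit1987] II.1.9 (iii) (kernel, p775363); node
card `Cruxes/BDPSelmerLowerDivisibilityAtTwo/Lines/split_prime_line_finite_two.md`.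
-/

set_option autoImplicit false
-- D-0017: the summit and its sub-problem share the name `BirchSwinnertonDyer`.
set_option linter.dupNamespace false

noncomputable section

open scoped Classical

namespace Summit.BirchSwinnertonDyer.BirchSwinnertonDyer.Theorems.TwoAdicBDPEisensteinDevissage

open NumberField IsDedekindDomain Field WeierstrassCurve
open Literature.NumberTheory.GaloisRepresentations Literature.NumberTheory.EllipticCurves
  Literature.NumberTheory.EllipticCurves.GreenbergSelmer Literature.NumberTheory.EllipticCurves.GreenbergVatsal2000
  Literature.NumberTheory.IwasawaTheory

/-- **`H¹_{nr outside v}(K_∞, (ℚ_p/ℤ_p)(𝟙))[p]` is finite under ONE print fact** (Oukhaba–Viguié 2016 Thm 1.2, `μ = 0`): t42's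
`finite_pTorsion_unrSelmer_empty_of_printFacts` with Greenberg 1978 §4 supplied by the kernel theorem
`TwoAdicBDPSplitPrimeTorsion.greenberg1978_splitPrime_iwasawaModule_finite_torsion_holds`. ANY prime `p`.
[cite: OukhabaViguie2016MuInvariant, Thm. 1.2 (arXiv:1311.3565 p0002 L6)] [cite: Greenberg1978, §4] -/
theorem finite_pTorsion_unrSelmer_empty_of_muZero {K : Type} [Field K] [NumberField K] {p : ℕ} [Fact p.Prime]
    (hOV : OukhabaViguie2016.thm12_splitPrime_muInvariant_eq_zero)
    (hK : IsImaginaryQuadratic K) {v vbar : HeightOneSpectrum (𝓞 K)} (hv : ((p : ℕ) : 𝓞 K) ∈ v.asIdeal)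
    (hvbar : ((p : ℕ) : 𝓞 K) ∈ vbar.asIdeal) (hne : vbar ≠ v) {κ : ZpExtension K p} (hκ : κ.IsUnramifiedOutside v) :
    Set.Finite {t : subgroupH1 κ.kerSubgroup (trivialCharacterModule K p) |
      t ∈ datumSelmerInfty κ (trivialCharacterModule K p)
        (Castella2018.AcSelmer.bdpData (trivialCharacterModule K p) p vbar) (∅ : Set (HeightOneSpectrum (𝓞 K))) ∧
      p • t = 0} :=
  TwoAdicBDPTrivialCharLine.finite_pTorsion_unrSelmer_empty_of_printFacts
    TwoAdicBDPSplitPrimeTorsion.greenberg1978_splitPrime_iwasawaModule_finite_torsion_holds hOV hK hv hvbar hne hκ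

/-- **`H¹_{nr outside v}^{S₀}(K_∞, (ℚ_p/ℤ_p)(𝟙))[p]` is finite for every finite `S₀`, under ONE print fact** (`μ = 0`): t42's
`finite_pTorsion_unrSelmer_of_printFacts` with `hGr` and `hdec` (de Shalit II.1.9 (iii), `deShalit1987_propII19iii_holds`) supplied by
kernel theorems. ANY prime `p`. [cite: OukhabaViguie2016MuInvariant, Thm. 1.2 (arXiv:1311.3565 p0002 L6)] [cite: Greenberg1978, §4]
[cite: deShalit1987, II §1.9 (iii)] -/
theorem finite_pTorsion_unrSelmer_of_muZero {K : Type} [Field K] [NumberField K] {p : ℕ} [Fact p.Prime]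
    (hOV : OukhabaViguie2016.thm12_splitPrime_muInvariant_eq_zero)
    (hK : IsImaginaryQuadratic K) {v vbar : HeightOneSpectrum (𝓞 K)} (hv : ((p : ℕ) : 𝓞 K) ∈ v.asIdeal)
    (hvbar : ((p : ℕ) : 𝓞 K) ∈ vbar.asIdeal) (hne : vbar ≠ v) {κ : ZpExtension K p} (hκ : κ.IsUnramifiedOutside v)
    {S₀ : Set (HeightOneSpectrum (𝓞 K))} (hS₀ : S₀.Finite) :
    Set.Finite {t : subgroupH1 κ.kerSubgroup (trivialCharacterModule K p) |
      t ∈ datumSelmerInfty κ (trivialCharacterModule K p)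
        (Castella2018.AcSelmer.bdpData (trivialCharacterModule K p) p vbar) S₀ ∧ p • t = 0} :=
  TwoAdicBDPTrivialCharLine.finite_pTorsion_unrSelmer_of_printFacts
    TwoAdicBDPSplitPrimeTorsion.greenberg1978_splitPrime_iwasawaModule_finite_torsion_holds hOV
    TwoAdicBDPSplitLineDecomposition.deShalit1987_propII19iii_holds hK hv hvbar hne hκ hS₀

/-- **v8's P4 `TrivialCharSplitLineFiniteAtTwo` (unfolded) under ONE print fact** (`μ = 0`, Oukhaba–Viguié 2016 Thm 1.2): for the
lead's next re-cut, `stub_trivialCharSplitLineFinite := fun K _ _ ↦ trivialCharSplitLineFiniteAtTwo_of_muZero hOV K`.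
[cite: OukhabaViguie2016MuInvariant, Thm. 1.2 (arXiv:1311.3565 p0002 L6)] [cite: Greenberg1978, §4] -/
theorem trivialCharSplitLineFiniteAtTwo_of_muZero
    (hOV : OukhabaViguie2016.thm12_splitPrime_muInvariant_eq_zero)
    (K : Type) [Field K] [NumberField K] :
    IsImaginaryQuadratic K → ∀ (v vbar : HeightOneSpectrum (𝓞 K)) (κ : ZpExtension K 2)
      (S₀ : Set (HeightOneSpectrum (𝓞 K))), S₀.Finite →
      ((2 : ℕ) : 𝓞 K) ∈ v.asIdeal → ((2 : ℕ) : 𝓞 K) ∈ vbar.asIdeal → vbar ≠ v →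
      Literature.NumberTheory.FaltingsSerre.inertiaOutside K {v} ⊆
        ((κ.kerSubgroup : Subgroup (Field.absoluteGaloisGroup K)) : Set (Field.absoluteGaloisGroup K)) →
      Set.Finite {t : Literature.NumberTheory.EllipticCurves.subgroupH1 κ.kerSubgroup
          (KellerYin2024.charModule (∅ : Set (PadicAlgCl 2))
            (1 : FramedGaloisRep K (padicCoeffIntegers (∅ : Set (PadicAlgCl 2))) 1)) |
        t ∈ datumSelmerInfty κ
            (KellerYin2024.charModule (∅ : Set (PadicAlgCl 2))
              (1 : FramedGaloisRep K (padicCoeffIntegers (∅ : Set (PadicAlgCl 2))) 1))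
            (Castella2018.AcSelmer.bdpData
              (KellerYin2024.charModule (∅ : Set (PadicAlgCl 2))
                (1 : FramedGaloisRep K (padicCoeffIntegers (∅ : Set (PadicAlgCl 2))) 1)) 2 vbar) S₀ ∧
          2 • t = 0} :=
  trivialCharSplitLineFiniteAtTwo_of_twoPrintFacts
    TwoAdicBDPSplitPrimeTorsion.greenberg1978_splitPrime_iwasawaModule_finite_torsion_holds hOV K

/-- **P1 `SplitPrimeLineSelmerFiniteAt W K` on habitat (β) under ONE print fact** (seat 2's decl, unfolded): for `W/ℚ` with `E[2]`
reducible and `K` imaginary quadratic with `2 = v v̄` split, over EVERY `ℤ₂`-extension of `K` ramified only at the relaxed prime `v`,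
the `2`-torsion of Greenberg's BDP-type Selmer group of `E_K[2^∞]` is finite, GIVEN OV16 Thm 1.2 only (P5 ∘ P4 with Gr78 §4 kernel).
[cite: OukhabaViguie2016MuInvariant, Thm. 1.2] [cite: Greenberg1978, §4] [cite: CastellaGrossiLeeSkinner2022, §1.4 Props. 17–18] -/
theorem lineSelmerTwoTorsionFinite_of_muZero (W : WeierstrassCurve ℚ) [W.IsElliptic]
    (K : Type) [Field K] [NumberField K] (hred : ¬ W.HasIrreducibleModPGaloisRep 2)
    (hOV : OukhabaViguie2016.thm12_splitPrime_muInvariant_eq_zero)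
    (hK : IsImaginaryQuadratic K) (v vbar : HeightOneSpectrum (𝓞 K)) (κ₂ : ZpExtension K 2)
    (hv : ((2 : ℕ) : 𝓞 K) ∈ v.asIdeal) (hvbar : ((2 : ℕ) : 𝓞 K) ∈ vbar.asIdeal) (hne : vbar ≠ v)
    (hram : Literature.NumberTheory.FaltingsSerre.inertiaOutside K {v} ⊆
      ((κ₂.kerSubgroup : Subgroup (Field.absoluteGaloisGroup K)) : Set (Field.absoluteGaloisGroup K))) :
    Set.Finite {t : (W.baseChange K).subgroupH1 2 κ₂.kerSubgroup |
      t ∈ datumSelmerInfty κ₂ ((W.baseChange K).geomPrimaryTorsion 2)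
        (Castella2018.AcSelmer.bdpData ((W.baseChange K).geomPrimaryTorsion 2) 2 vbar) ∅ ∧ 2 • t = 0} :=
  lineSelmerTwoTorsionFinite_of_twoPrintFacts W K hred
    TwoAdicBDPSplitPrimeTorsion.greenberg1978_splitPrime_iwasawaModule_finite_torsion_holds hOV hK v vbar κ₂ hv hvbar hne hram

end Summit.BirchSwinnertonDyer.BirchSwinnertonDyer.Theorems.TwoAdicBDPEisensteinDevissage

end
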